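import Literature.NumberTheory.Sieve.PolymathBoundedGaps
import Literature.NumberTheory.Sieve.GoldstonPintzYildirim
import Literature.NumberTheory.Sieve.MaynardSieve
import Mathlib.NumberTheory.Primorial
import HarnessLib

/-!
# Polymath 8b: the criterion for `DHL` (Lemma 3.4), the sieve asymptotics (Theorems 3.5(i), 3.6(i)) and the sieve-theoretic part of Theorem 3.12(i)

Trunk: AntSieve / parity.S13.  Second layer of the decomposition of the named fact
`Literature.NumberTheory.Sieve.frequently_nth_prime_succ_le_add_polymath` (`H₁ ≤ 246`; D. H. J. Polymath, *Variants of the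
Selberg sieve, and bounded intervals containing many primes*, Res. Math. Sci. 1:12 (2014) =
arXiv:1407.4897, Theorem 1.4(i)).  `PolymathBoundedGaps.lean` reduces Theorem 1.4(i) to Bombieri–Vinogradov,
the numerical Theorem 3.13(i) and the `ε`-enlarged sieve Theorem 3.12(i)
(`weakDHL_of_polymathFunctional_gt`).  This file vendors the printed ingredients of Theorem 3.12(i)
(§3, pp. 8–9 and §5.3, pp. 21–23 of the arXiv version) and proves the sieve-theoretic part of its proof:

* `weakDHL_of_sieveWeights`: **Lemma 3.4** (criterion for `DHL`), PROVED (pigeonhole, as printed), with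
  the normalisations `w = log log log x`, `W = ∏_{p ≤ w} p`, `B = (φ(W)/W) log x` (`polymathw`,
  `polymathW`, `polymathB`), `θ(n)` (`GPY.theta` of `GoldstonPintzYildirim.lean`) and the summation range
  `{x ≤ n ≤ 2x : n = b (W)}`
  (`polymathRange`); the residue class `b (W)` with all `b + hᵢ` coprime to `W` comes from admissibility
  and the Chinese remainder theorem (`exists_forall_gcd_add_primorial_eq_one` of `MaynardSieve.lean`).
* `divisorSumWeight F x n = λ_F(n) = ∑_{d ∣ n} μ(d) F(log d / log x)` (p. 9) and `IsSieveCutoff F s`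
  ("`F : [0,+∞) → ℝ` smooth, compactly supported, `S(F) ≤ s`", (S-def) p. 9).
* Named facts (NOT proved here; they are the multidimensional Selberg sieve computations of §4):
  `theta_divisorSumWeights_asymptotic` (**Theorem 3.5(i)**, asymptotic for prime sums under `EH[ϑ]`)
  and `divisorSumWeights_asymptotic` (**Theorem 3.6(i)**, asymptotic for non-prime sums, trivial case).
* `weakDHL_of_tensorWeights`: the sieve-theoretic part of the proof of **Theorem 3.12(i)** (§5.3), PROVED:
  for weights `ν(n) = (∑_j c_j ∏ᵢ λ_{f_{i,j}}(n + hᵢ))²` built from smooth cutoffs with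
  `∑ᵢ (S(f_{i,j}) + S(f_{i,j'})) < 1` and, for `j' ∈ 𝒥₁(i₀)`, `∑_{i ≠ i₀} (S(f_{i,j}) + S(f_{i,j'})) < ϑ`,
  Theorems 3.6(i)/3.5(i), the pointwise bound `(x₁ + x₂)² ≥ (x₁ + 2x₂) x₁` (p. 22) and Lemma 3.4 give
  `DHL[k, m+1]` as soon as `m α < β₁ + ⋯ + β_k` (`tensorAlpha`, `tensorBeta` are the printed `α`, `βᵢ`).
* Named fact `exists_tensorCutoffs_of_polymathFunctional_gt`: the remaining, purely real-analytic step of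
  §5.3 (with §5.1): a test function with `(∑ᵢ J_{i,1-ε}(F))/I(F) > 2m/ϑ` yields such cutoffs with
  `∑ᵢ S(f_{i,j}) < (1+ε)ϑ/2` and `m α < ∑ᵢ βᵢ` (truncation, rescaling, mollification, Stone–Weierstrass,
  smooth partition; pp. 19–23).  NOT proved here (no number theory is involved; it is isolated so that it
  can be discharged independently).
* `weakDHL_of_polymathFunctional_gt_of_parts`: **Theorem 3.12(i)** (`weakDHL_of_polymathFunctional_gt` of
  `PolymathBoundedGaps.lean`) from the three named facts, PROVED (the support bookkeeping of p. 22).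

## Rendering of the asymptotic conventions (Definition 1.6, p. 5)

* `x` is a real parameter `→ +∞`; objects "not fixed" may depend on `x`: the residue class is a function
  `b : ℝ → ℤ` (it must depend on `x`, as `W = W(x)` does), the weight is `ν : ℝ → ℕ → ℝ`, and `λ_F`
  carries `x` explicitly.  "Fixed" objects (`k`, `m`, the tuple, `α`, `βᵢ`, the cutoffs `F_i, G_i`, `ϑ`)
  are quantified before `x`.
* `X ≤ (α + o(1)) Y` / `X ≥ (β - o(1)) Y` (Lemma 3.4) are rendered `∀ δ > 0, ∀ᶠ x in atTop, X ≤ (α+δ) Y`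
  resp. `(β-δ) Y ≤ X`; `X = (c + o(1)) Y` (Theorems 3.5, 3.6) is rendered `(X - c Y) =o[atTop] Y`.
* `n = b (W)`, `x ≤ n ≤ 2x` is the `Finset` `polymathRange x b` of natural numbers; `θ(n + hᵢ)` and
  `λ_F(n + hᵢ)` are evaluated at `((n : ℤ) + hᵢ).toNat` (for `x` large `n + hᵢ > 0`; only large `x` matter).
* `EH[ϑ]` is rendered by `PrimesHaveLevel ϑ` (`LevelOfDistribution.lean`), exactly as in the tree's
  rendering `frequently_card_primes_ge_of_maynardFunctional` of Theorem 3.8 and in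
  `weakDHL_of_polymathFunctional_gt`; the support hypothesis of Theorem 3.5(i) is open in `ϑ`, so the
  rendering follows from the printed theorem at a slightly smaller `ϑ`.
* Smooth `F : [0,+∞) → ℝ` is rendered as `F : ℝ → ℝ` with `ContDiff ℝ ∞ F` (a smooth function on the
  half-line extends smoothly to `ℝ`); only values on `[0,+∞)` are used (`log d / log x ≥ 0` for `d ≥ 1`,
  `x > 1`, and `c` integrates over `[0, 1]`).  `S(F) ≤ s` is `∀ t > s, F t = 0` with `0 ≤ s`.

## References

* D. H. J. Polymath, *Variants of the Selberg sieve, and bounded intervals containing many primes*,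
  Res. Math. Sci. 1 (2014), Art. 12; arXiv:1407.4897. [Polymath8b2014]
* J. Maynard, *Small gaps between primes*, Ann. of Math. 181 (2015), 383–413 (Prop. 4.1, proved in
  §§5–6, is Theorems 3.5(i)/3.6(i) for `F = G`). [MaynardAnnals2015]
-/

noncomputable section

open MeasureTheory Filter Finset Asymptotics
open scoped BigOperators Topology

namespace Literature.NumberTheory.Sieve

/-! ### Normalisations of §3: `w`, `W`, `B`, `θ(n)` and the summation range -/

/-- `w := log log log x` (Polymath 8b, §3, p. 8). [cite: Polymath8b2014, §3, p. 8 (definition of w)] -/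
def polymathw (x : ℝ) : ℝ := Real.log (Real.log (Real.log x))

/-- `W := ∏_{p ≤ w} p`, as the primorial of `⌊w⌋₊` (Polymath 8b, §3, p. 8). [cite: Polymath8b2014, §3, p. 8 (definition of W)] -/
def polymathW (x : ℝ) : ℕ := primorial ⌊polymathw x⌋₊

/-- `W > 0`. [folklore] -/
theorem polymathW_pos (x : ℝ) : 0 < polymathW x := primorial_pos _

/-- `φ(W) > 0`. [folklore] -/
theorem totient_polymathW_pos (x : ℝ) : 0 < Nat.totient (polymathW x) :=
  Nat.totient_pos.2 (polymathW_pos x)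

/-- The normalisation constant `B := (φ(W)/W) log x` of Lemma 3.4 (Polymath 8b, (bnorm), p. 8). [cite: Polymath8b2014, Lemma 3.4 (definition of B)] -/
def polymathB (x : ℝ) : ℝ :=
  (Nat.totient (polymathW x) : ℝ) / (polymathW x : ℝ) * Real.log x

/-- `B > 0` for `x > 1`. [folklore] -/
theorem polymathB_pos {x : ℝ} (hx : 1 < x) : 0 < polymathB x :=
  mul_pos (div_pos (Nat.cast_pos.2 (totient_polymathW_pos x)) (Nat.cast_pos.2 (polymathW_pos x)))
    (Real.log_pos hx)

/-- The summation range `{x ≤ n ≤ 2x : n = b (W)}` of Lemma 3.4 and Theorems 3.5–3.6, as a finite set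
of natural numbers (Polymath 8b, (s1)–(s2), p. 8). [cite: Polymath8b2014, Lemma 3.4] -/
def polymathRange (x : ℝ) (b : ℤ) : Finset ℕ :=
  (Finset.Icc ⌈x⌉₊ ⌊2 * x⌋₊).filter fun n => (n : ℤ) ≡ b [ZMOD (polymathW x : ℤ)]

/-- Members of the summation range satisfy `x ≤ n ≤ 2x`. [folklore] -/
theorem le_of_mem_polymathRange {x : ℝ} {b : ℤ} {n : ℕ} (hx : 0 ≤ x)
    (hn : n ∈ polymathRange x b) : x ≤ n ∧ (n : ℝ) ≤ 2 * x := by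
  have h := Finset.mem_Icc.1 (Finset.mem_filter.1 hn).1
  exact ⟨Nat.ceil_le.1 h.1, (Nat.le_floor_iff (by positivity)).1 h.2⟩

/-- (bnorm): `B^k W = B^{k-1} φ(W) log x`, the identity behind "From (bnorm) and the crucial condition
(key), it follows that `N > 0`" (Polymath 8b, proof of Lemma 3.4). [cite: Polymath8b2014, Lemma 3.4 (proof)] -/
theorem polymathB_pow_mul_W {x : ℝ} {k : ℕ} (hk : 1 ≤ k) :
    polymathB x ^ k * (polymathW x : ℝ) =
      polymathB x ^ (k - 1) * (Nat.totient (polymathW x) : ℝ) * Real.log x := by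
  have hW : (polymathW x : ℝ) ≠ 0 := Nat.cast_ne_zero.2 (polymathW_pos x).ne'
  obtain ⟨j, rfl⟩ : ∃ j, k = j + 1 := ⟨k - 1, by omega⟩
  simp only [Nat.add_sub_cancel, pow_succ, polymathB]
  field_simp

/-- For `n ≤ 2x` and `h ≤ x` one has `θ(n + h) ≤ log 3x` (Polymath 8b, proof of Lemma 3.4: the sum
`∑ᵢ θ(n + hᵢ) - m log 3x` "can be positive only if `n + hᵢ` is prime for at least `m + 1` indices").
[cite: Polymath8b2014, Lemma 3.4 (proof)] -/
theorem theta_toNat_le {x : ℝ} (hx : 1 ≤ x) {n : ℕ} (hn : (n : ℝ) ≤ 2 * x) {h : ℤ}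
    (hh : (h : ℝ) ≤ x) : GPY.theta ((n : ℤ) + h).toNat ≤ Real.log (3 * x) := by
  refine (GPY.theta_le_log _).trans ?_
  rcases Nat.eq_zero_or_pos ((n : ℤ) + h).toNat with h0 | hpos
  · rw [h0, Nat.cast_zero, Real.log_zero]
    exact Real.log_nonneg (by linarith)
  · refine Real.log_le_log (by exact_mod_cast hpos) ?_
    have h1 : ((((n : ℤ) + h).toNat : ℕ) : ℤ) = (n : ℤ) + h := Int.toNat_of_nonneg (by omega)
    have h2 : ((((n : ℤ) + h).toNat : ℕ) : ℝ) = (n : ℝ) + (h : ℝ) := by exact_mod_cast h1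
    rw [h2]
    linarith

/-! ### Lemma 3.4: the criterion for `DHL[k, m+1]` -/

/-- **Polymath 8b, Lemma 3.4** (criterion for `DHL`).  Let `k ≥ 2` and `m ≥ 1` be fixed and
`B := (φ(W)/W) log x`.  Suppose that for each fixed admissible `k`-tuple `(h₁, …, h_k)` and each residue
class `b (W)` such that `b + hᵢ` is coprime to `W` for all `i`, one can find a non-negative weight
`ν : ℕ → ℝ⁺` and fixed `α > 0`, `β₁, …, β_k ≥ 0` with the asymptotic upper bound
`∑_{x ≤ n ≤ 2x, n = b (W)} ν(n) ≤ (α + o(1)) B^{-k} x/W` (s1), the asymptotic lower bounds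
`∑_{x ≤ n ≤ 2x, n = b (W)} ν(n) θ(n + hᵢ) ≥ (βᵢ - o(1)) B^{1-k} x/φ(W)` (s2) for all `i`, and the key
inequality `(β₁ + ⋯ + β_k)/α > m` (key).  Then `DHL[k, m+1]` holds.  Rendering (module docstring): the
class `b` and the weight `ν` may depend on `x` (`b : ℝ → ℤ`, `ν : ℝ → ℕ → ℝ`), `βᵢ` is indexed by the
elements `h ∈ H` of the tuple, and `o(1)` is spelled out with `∀ δ > 0, ∀ᶠ x in atTop`.  Proof as printed:
`N := ∑ ν(n) (∑ᵢ θ(n + hᵢ) - m log 3x) > 0` for large `x`, and a positive summand forces `m + 1` primes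
among the `n + hᵢ`. [cite: Polymath8b2014, Lemma 3.4] -/
theorem weakDHL_of_sieveWeights {k m : ℕ} (hk : 2 ≤ k) (hm : 1 ≤ m)
    (hyp : ∀ (H : Finset ℤ), IsAdmissibleTuple H → H.card = k →
      ∀ (b : ℝ → ℤ), (∀ x, ∀ h ∈ H, Int.gcd (b x + h) (polymathW x) = 1) →
      ∃ (ν : ℝ → ℕ → ℝ) (α : ℝ) (β : ℤ → ℝ), (∀ x n, 0 ≤ ν x n) ∧ 0 < α ∧ (∀ h ∈ H, 0 ≤ β h) ∧
        (∀ δ : ℝ, 0 < δ → ∀ᶠ x : ℝ in atTop,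
          ∑ n ∈ polymathRange x (b x), ν x n ≤
            (α + δ) * x / (polymathB x ^ k * polymathW x)) ∧
        (∀ h ∈ H, ∀ δ : ℝ, 0 < δ → ∀ᶠ x : ℝ in atTop,
          (β h - δ) * x / (polymathB x ^ (k - 1) * Nat.totient (polymathW x)) ≤
            ∑ n ∈ polymathRange x (b x), ν x n * GPY.theta ((n : ℤ) + h).toNat) ∧
        (m : ℝ) < (∑ h ∈ H, β h) / α) :
    WeakDicksonHardyLittlewood k (m + 1) := by
  intro H hH hcard
  -- a residue class `b (W)` with `b + h` coprime to `W` for all `h ∈ H` (CRT, `MaynardSieve.lean`)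
  choose b0 hb0 using fun N : ℕ => exists_forall_gcd_add_primorial_eq_one hH N
  set b : ℝ → ℤ := fun x => (b0 ⌊polymathw x⌋₊ : ℤ) with hbdef
  have hb : ∀ x, ∀ h ∈ H, Int.gcd (b x + h) (polymathW x) = 1 := fun x h hh => hb0 _ h hh
  obtain ⟨ν, α, β, hν, hα, hβ, hU, hL, hkey⟩ := hyp H hH hcard b hb
  have hkey' : (m : ℝ) * α < ∑ h ∈ H, β h := (lt_div_iff₀ hα).1 hkey
  set g : ℝ := ∑ h ∈ H, β h - m * α with hg
  have hg0 : 0 < g := by linarith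
  have hkm : (0 : ℝ) < k + m := by positivity
  set δ : ℝ := g / (2 * (k + m)) with hδ
  have hδ0 : 0 < δ := by positivity
  have hδkm : (k + m : ℝ) * δ = g / 2 := by
    rw [hδ]; field_simp
  set C : ℝ := 2 * m * (α + δ) * Real.log 3 / g + 1 with hC
  set T : ℝ := ∑ h ∈ H, |(h : ℝ)| with hT
  have hLall : ∀ᶠ x : ℝ in atTop, ∀ h ∈ H,
      (β h - δ) * x / (polymathB x ^ (k - 1) * Nat.totient (polymathW x)) ≤
        ∑ n ∈ polymathRange x (b x), ν x n * GPY.theta ((n : ℤ) + h).toNat :=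
    (Finset.eventually_all H).2 fun h hh => hL h hh δ hδ0
  refine Filter.frequently_atTop.2 fun N => ?_
  obtain ⟨x, hxU, hxL, hxN, hxT, hx1, hxC⟩ := ((hU δ hδ0).and (hLall.and ((eventually_ge_atTop (N : ℝ)).and
    ((eventually_ge_atTop T).and ((eventually_gt_atTop (1 : ℝ)).and
      (Real.tendsto_log_atTop.eventually_ge_atTop C)))))).exists
  -- notation
  set R := polymathRange x (b x) with hR
  set M : ℝ := x / (polymathB x ^ k * polymathW x) with hM
  have hB : 0 < polymathB x := polymathB_pos hx1
  have hW : (0 : ℝ) < polymathW x := Nat.cast_pos.2 (polymathW_pos x)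
  have hφ : (0 : ℝ) < Nat.totient (polymathW x) := Nat.cast_pos.2 (totient_polymathW_pos x)
  have hlog : 0 < Real.log x := Real.log_pos hx1
  have hM0 : 0 < M := by positivity
  have hM' : x / (polymathB x ^ (k - 1) * Nat.totient (polymathW x)) = M * Real.log x := by
    rw [hM, polymathB_pow_mul_W (by omega : 1 ≤ k)]
    field_simp
  have hlog3 : Real.log (3 * x) = Real.log 3 + Real.log x := by
    rw [Real.log_mul (by norm_num) (by linarith)]
  have hlog3pos : 0 < Real.log (3 * x) := Real.log_pos (by linarith)
  -- each `h ∈ H` is at most `x` in size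
  have hhx : ∀ h ∈ H, (h : ℝ) ≤ x := fun h hh =>
    ((le_abs_self (h : ℝ)).trans (Finset.single_le_sum (f := fun h : ℤ => |(h : ℝ)|)
      (fun _ _ => abs_nonneg _) hh)).trans hxT
  -- the quantity `N` of the printed proof
  set Nsum : ℝ := ∑ n ∈ R, ν x n * (∑ h ∈ H, GPY.theta ((n : ℤ) + h).toNat - m * Real.log (3 * x))
    with hNsum
  have hNsum_eq : Nsum = ∑ h ∈ H, ∑ n ∈ R, ν x n * GPY.theta ((n : ℤ) + h).toNat -
      m * Real.log (3 * x) * ∑ n ∈ R, ν x n := by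
    rw [hNsum, Finset.sum_comm, Finset.mul_sum, ← Finset.sum_sub_distrib]
    refine Finset.sum_congr rfl fun n _ => ?_
    rw [mul_sub, Finset.mul_sum]
    ring
  have hlow : (∑ h ∈ H, β h - k * δ) * (M * Real.log x) ≤
      ∑ h ∈ H, ∑ n ∈ R, ν x n * GPY.theta ((n : ℤ) + h).toNat := by
    calc (∑ h ∈ H, β h - k * δ) * (M * Real.log x)
        = ∑ h ∈ H, (β h - δ) * (M * Real.log x) := by
          simp only [sub_mul, Finset.sum_mul, Finset.sum_sub_distrib, Finset.sum_const, hcard,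
            nsmul_eq_mul]
          ring
      _ ≤ ∑ h ∈ H, ∑ n ∈ R, ν x n * GPY.theta ((n : ℤ) + h).toNat :=
          Finset.sum_le_sum fun h hh => by
            have := hxL h hh
            rwa [mul_div_assoc, hM'] at this
  have hup : m * Real.log (3 * x) * ∑ n ∈ R, ν x n ≤ m * Real.log (3 * x) * ((α + δ) * M) := by
    refine mul_le_mul_of_nonneg_left ?_ (by positivity)
    rwa [hM, ← mul_div_assoc]
  have hNsum_pos : 0 < Nsum := by
    have h1 : (∑ h ∈ H, β h - k * δ) * (M * Real.log x) - m * Real.log (3 * x) * ((α + δ) * M) ≤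
        Nsum := by rw [hNsum_eq]; linarith
    refine lt_of_lt_of_le ?_ h1
    have h2 : (∑ h ∈ H, β h - k * δ) * (M * Real.log x) - m * Real.log (3 * x) * ((α + δ) * M) =
        M * (g / 2 * Real.log x - m * (α + δ) * Real.log 3) := by
      rw [hlog3]
      have : (∑ h ∈ H, β h - k * δ) = g + m * α - k * δ := by rw [hg]; ring
      rw [this]
      have : (k : ℝ) * δ = g / 2 - m * δ := by linarith
      rw [this]
      ring
    rw [h2]
    refine mul_pos hM0 ?_
    have h3 : 2 * m * (α + δ) * Real.log 3 / g + 1 ≤ Real.log x := hxC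
    have h4 : 2 * m * (α + δ) * Real.log 3 / g * g = 2 * m * (α + δ) * Real.log 3 := by
      field_simp
    nlinarith [mul_le_mul_of_nonneg_right h3 hg0.le]
  -- a good `n`
  obtain ⟨n, hnR, hn⟩ : ∃ n ∈ R,
      (0 : ℝ) < ν x n * (∑ h ∈ H, GPY.theta ((n : ℤ) + h).toNat - m * Real.log (3 * x)) :=
    Finset.exists_lt_of_sum_lt (by rwa [Finset.sum_const_zero])
  have hpos : m * Real.log (3 * x) < ∑ h ∈ H, GPY.theta ((n : ℤ) + h).toNat := by
    by_contra hle
    exact (not_le.2 hn) (mul_nonpos_iff.2 (Or.inl ⟨hν x n, by linarith⟩))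
  obtain ⟨hxn, hn2x⟩ := le_of_mem_polymathRange (by linarith) hnR
  refine ⟨n, ?_, ?_⟩
  · exact_mod_cast hxN.trans hxn
  · set Q := H.filter fun h ↦ 0 < (n : ℤ) + h ∧ ((n : ℤ) + h).toNat.Prime with hQ
    have hsum_le : ∑ h ∈ H, GPY.theta ((n : ℤ) + h).toNat ≤ #Q * Real.log (3 * x) := by
      calc ∑ h ∈ H, GPY.theta ((n : ℤ) + h).toNat
          ≤ ∑ h ∈ H, (if 0 < (n : ℤ) + h ∧ ((n : ℤ) + h).toNat.Prime then Real.log (3 * x) else 0) :=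
            Finset.sum_le_sum fun h hh => by
              split_ifs with hc
              · exact theta_toNat_le hx1.le hn2x (hhx h hh)
              · rw [GPY.theta_of_not_prime]
                intro hp
                refine hc ⟨?_, hp⟩
                by_contra hle
                rw [Int.toNat_of_nonpos (not_lt.1 hle)] at hp
                exact Nat.not_prime_zero hp
        _ = #Q * Real.log (3 * x) := by
            rw [Finset.sum_ite, Finset.sum_const_zero, add_zero, Finset.sum_const, nsmul_eq_mul]
    have hlt : (m : ℝ) < #Q := by
      by_contra hle
      push Not at hle
      have := mul_le_mul_of_nonneg_right hle hlog3pos.le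
      linarith
    exact_mod_cast hlt


/-- **Lemma 3.4, variant**: the sign conditions `α > 0`, `βᵢ ≥ 0` and the division in (key) can be
dropped (`(key)` as `m α < ∑ᵢ βᵢ`): the upper bound (s1) with `ν ≥ 0` forces `α ≥ 0`, negative `βᵢ` may
be replaced by `0`, and `α` may be enlarged slightly.  This is the form in which §5 applies the lemma.
[cite: Polymath8b2014, Lemma 3.4] -/
theorem weakDHL_of_sieveWeights' {k m : ℕ} (hk : 2 ≤ k) (hm : 1 ≤ m)
    (hyp : ∀ (H : Finset ℤ), IsAdmissibleTuple H → H.card = k →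
      ∀ (b : ℝ → ℤ), (∀ x, ∀ h ∈ H, Int.gcd (b x + h) (polymathW x) = 1) →
      ∃ (ν : ℝ → ℕ → ℝ) (α : ℝ) (β : ℤ → ℝ), (∀ x n, 0 ≤ ν x n) ∧
        (∀ δ : ℝ, 0 < δ → ∀ᶠ x : ℝ in atTop,
          ∑ n ∈ polymathRange x (b x), ν x n ≤
            (α + δ) * x / (polymathB x ^ k * polymathW x)) ∧
        (∀ h ∈ H, ∀ δ : ℝ, 0 < δ → ∀ᶠ x : ℝ in atTop,
          (β h - δ) * x / (polymathB x ^ (k - 1) * Nat.totient (polymathW x)) ≤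
            ∑ n ∈ polymathRange x (b x), ν x n * GPY.theta ((n : ℤ) + h).toNat) ∧
        (m : ℝ) * α < ∑ h ∈ H, β h) :
    WeakDicksonHardyLittlewood k (m + 1) := by
  refine weakDHL_of_sieveWeights hk hm fun H hH hcard b hb => ?_
  obtain ⟨ν, α, β, hν, hU, hL, hkey⟩ := hyp H hH hcard b hb
  -- `α ≥ 0` is forced by the upper bound
  have hα : 0 ≤ α := by
    by_contra hαneg
    push Not at hαneg
    obtain ⟨x, hx, hx1⟩ := ((hU (-α / 2) (by linarith)).and (eventually_gt_atTop 1)).exists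
    have hM : 0 < x / (polymathB x ^ k * polymathW x) := by
      have := polymathB_pos hx1
      have := polymathW_pos x
      positivity
    have h0 : 0 ≤ ∑ n ∈ polymathRange x (b x), ν x n := Finset.sum_nonneg fun n _ => hν x n
    have : (α + -α / 2) * x / (polymathB x ^ k * ↑(polymathW x)) < 0 := by
      rw [mul_div_assoc]
      exact mul_neg_of_neg_of_pos (by linarith) hM
    linarith
  -- room in the key inequality
  have hmpos : (0 : ℝ) < m := by exact_mod_cast hm
  have hle : ∑ h ∈ H, β h ≤ ∑ h ∈ H, max (β h) 0 := Finset.sum_le_sum fun h _ => le_max_left _ _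
  set η : ℝ := (∑ h ∈ H, β h - m * α) / (2 * m) with hη
  have hη0 : 0 < η := div_pos (by linarith) (by positivity)
  have hηkey : (m : ℝ) * (α + η) < ∑ h ∈ H, max (β h) 0 := by
    have : (m : ℝ) * (α + η) = (m * α + ∑ h ∈ H, β h) / 2 := by
      rw [hη]
      field_simp
      ring
    rw [this]
    linarith
  refine ⟨ν, α + η, fun h => max (β h) 0, hν, by linarith, fun h _ => le_max_right _ _, ?_, ?_, ?_⟩
  · intro δ hδ
    filter_upwards [hU δ hδ, eventually_gt_atTop 1] with x hx hx1
    refine hx.trans ?_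
    have hM : 0 < x / (polymathB x ^ k * polymathW x) := by
      have := polymathB_pos hx1
      have := polymathW_pos x
      positivity
    rw [mul_div_assoc, mul_div_assoc]
    gcongr
    linarith
  · intro h hh δ hδ
    show ∀ᶠ x : ℝ in atTop, (max (β h) 0 - δ) * x / (polymathB x ^ (k - 1) * Nat.totient (polymathW x)) ≤
      ∑ n ∈ polymathRange x (b x), ν x n * GPY.theta ((n : ℤ) + h).toNat
    rcases le_or_gt 0 (β h) with hb0 | hb0
    · rw [max_eq_left hb0]
      exact hL h hh δ hδ
    · rw [max_eq_right hb0.le]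
      filter_upwards [eventually_gt_atTop 1] with x hx1
      have hM : 0 < x / (polymathB x ^ (k - 1) * Nat.totient (polymathW x)) := by
        have := polymathB_pos hx1
        have := totient_polymathW_pos x
        positivity
      have h0 : 0 ≤ ∑ n ∈ polymathRange x (b x), ν x n * GPY.theta ((n : ℤ) + h).toNat :=
        Finset.sum_nonneg fun n _ => mul_nonneg (hν x n) (GPY.theta_nonneg _)
      have : (0 - δ) * x / (polymathB x ^ (k - 1) * ↑(polymathW x).totient) ≤ 0 := by
        rw [mul_div_assoc]
        exact mul_nonpos_iff.2 (Or.inr ⟨by linarith, hM.le⟩)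
      linarith
  · rwa [lt_div_iff₀ (by linarith)]

/-! ### Divisor sums `λ_F` and the asymptotics of Theorems 3.5 and 3.6 -/

open scoped ArithmeticFunction.Moebius in
/-- The divisor sum `λ_F(n) := ∑_{d ∣ n} μ(d) F(log_x d)`, `log_x d := log d / log x` (Polymath 8b,
(lambdaf-def), p. 9); the dependence on the asymptotic parameter `x` is explicit.  Junk values: `λ_F(0) = 0`
(`Nat.divisors 0 = ∅`), and for `x ≤ 1` the base-`x` logarithm is meaningless (only `x → ∞` matters).
[cite: Polymath8b2014, §3, p. 9 (definition of λ_F)] -/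
def divisorSumWeight (F : ℝ → ℝ) (x : ℝ) (n : ℕ) : ℝ :=
  ∑ d ∈ n.divisors, (μ d : ℝ) * F (Real.log d / Real.log x)

open scoped ContDiff in
/-- "`F : [0,+∞) → ℝ` is a fixed smooth compactly supported function with `S(F) ≤ s`", where
`S(F) := sup {t ≥ 0 : F(t) ≠ 0}` (`S(0) = 0`) is the upper range of the support (Polymath 8b, (S-def),
p. 9).  Rendered as: `F` smooth on `ℝ` (every smooth function on `[0,+∞)` so extends), `0 ≤ s`, and
`F(t) = 0` for `t > s`; only the values of `F` on `[0,+∞)` are ever used.  All hypotheses of Theorems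
3.5–3.6 are upper bounds on sums of the `S(Fᵢ)`, so an upper bound `s` is all that is needed.
[cite: Polymath8b2014, §3, p. 9, (S-def)] -/
structure IsSieveCutoff (F : ℝ → ℝ) (s : ℝ) : Prop where
  /-- `F` is smooth. -/
  contDiff : ContDiff ℝ ∞ F
  /-- the support bound is `≥ 0` (as `S(F) ≥ 0` by definition). -/
  nonneg : 0 ≤ s
  /-- `F` vanishes beyond `s`: `S(F) ≤ s`. -/
  eq_zero : ∀ t, s < t → F t = 0

/-! ### Named facts: the sieve asymptotics, Theorems 3.6(i) and 3.5(i) -/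

/-- **Polymath 8b, Theorem 3.6(i)** (asymptotic for non-prime sums, trivial case; proved in §4.1 from
Lemma 4.1, unconditionally).  Let `k ≥ 1` be fixed, `(h₁, …, h_k)` a fixed admissible `k`-tuple, and
`b (W)` such that `b + hᵢ` is coprime to `W` for each `i`.  For each `i` let `Fᵢ, Gᵢ : [0,+∞) → ℝ` be fixed
smooth compactly supported functions with `∑ᵢ (S(Fᵢ) + S(Gᵢ)) < 1`.  Then
`∑_{x ≤ n ≤ 2x, n = b (W)} ∏ᵢ λ_{Fᵢ}(n + hᵢ) λ_{Gᵢ}(n + hᵢ) = (c + o(1)) B^{-k} x/W` with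
`c := ∏ᵢ ∫₀¹ Fᵢ'(t) Gᵢ'(t) dt`.  Rendering: the tuple is a `Finset ℤ` and the cutoffs are indexed by its
elements; conventions as in the module docstring.  A multidimensional Selberg-sieve computation, NOT
proved here. [cite: Polymath8b2014, Theorem 3.6(i)] -/
def divisorSumWeights_asymptotic : Prop :=
  ∀ (H : Finset ℤ), IsAdmissibleTuple H → 1 ≤ #H →
  ∀ (b : ℝ → ℤ), (∀ x, ∀ h ∈ H, Int.gcd (b x + h) (polymathW x) = 1) →
  ∀ (F G : ℤ → ℝ → ℝ) (sF sG : ℤ → ℝ),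
    (∀ h ∈ H, IsSieveCutoff (F h) (sF h)) → (∀ h ∈ H, IsSieveCutoff (G h) (sG h)) →
    ∑ h ∈ H, (sF h + sG h) < 1 →
    (fun x : ℝ => ∑ n ∈ polymathRange x (b x),
          ∏ h ∈ H, (divisorSumWeight (F h) x ((n : ℤ) + h).toNat *
            divisorSumWeight (G h) x ((n : ℤ) + h).toNat)
        - (∏ h ∈ H, ∫ t in (0 : ℝ)..1, deriv (F h) t * deriv (G h) t) *
          (x / (polymathB x ^ #H * polymathW x)))
      =o[atTop] fun x : ℝ => x / (polymathB x ^ #H * polymathW x)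

/-- **Polymath 8b, Theorem 3.5(i)** (asymptotic for prime sums, Elliott–Halberstam case; proved in §4.2).
Let `k ≥ 2` be fixed, `(h₁, …, h_k)` a fixed admissible `k`-tuple, `b (W)` such that `b + hᵢ` is coprime
to `W` for each `i`, and `1 ≤ i₀ ≤ k` fixed; for each `i ≠ i₀` let `Fᵢ, Gᵢ : [0,+∞) → ℝ` be fixed smooth
compactly supported functions.  Assume (i): `EH[ϑ]` holds for some fixed `0 < ϑ < 1` and
`∑_{i ≠ i₀} (S(Fᵢ) + S(Gᵢ)) < ϑ`.  Then
`∑_{x ≤ n ≤ 2x, n = b (W)} θ(n + h_{i₀}) ∏_{i ≠ i₀} λ_{Fᵢ}(n + hᵢ) λ_{Gᵢ}(n + hᵢ) = (c + o(1)) B^{1-k} x/φ(W)`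
with `c := ∏_{i ≠ i₀} ∫₀¹ Fᵢ'(t) Gᵢ'(t) dt`.  Rendering: `EH[ϑ]` as `PrimesHaveLevel ϑ` (module
docstring; the support condition is open in `ϑ`), the tuple a `Finset ℤ` with distinguished element
`h₀`, cutoffs indexed by `H.erase h₀`.  NOT proved here. [cite: Polymath8b2014, Theorem 3.5(i)] -/
def theta_divisorSumWeights_asymptotic : Prop :=
  ∀ (H : Finset ℤ), IsAdmissibleTuple H → 2 ≤ #H →
  ∀ (b : ℝ → ℤ), (∀ x, ∀ h ∈ H, Int.gcd (b x + h) (polymathW x) = 1) →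
  ∀ h₀ ∈ H, ∀ (θ : ℝ), 0 < θ → θ < 1 → PrimesHaveLevel θ →
  ∀ (F G : ℤ → ℝ → ℝ) (sF sG : ℤ → ℝ),
    (∀ h ∈ H.erase h₀, IsSieveCutoff (F h) (sF h)) → (∀ h ∈ H.erase h₀, IsSieveCutoff (G h) (sG h)) →
    ∑ h ∈ H.erase h₀, (sF h + sG h) < θ →
    (fun x : ℝ => ∑ n ∈ polymathRange x (b x),
          GPY.theta ((n : ℤ) + h₀).toNat * ∏ h ∈ H.erase h₀, (divisorSumWeight (F h) x ((n : ℤ) + h).toNat *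
            divisorSumWeight (G h) x ((n : ℤ) + h).toNat)
        - (∏ h ∈ H.erase h₀, ∫ t in (0 : ℝ)..1, deriv (F h) t * deriv (G h) t) *
          (x / (polymathB x ^ (#H - 1) * Nat.totient (polymathW x))))
      =o[atTop] fun x : ℝ => x / (polymathB x ^ (#H - 1) * Nat.totient (polymathW x))


/-! ### `λ_F` at primes -/

open scoped ArithmeticFunction.Moebius in
/-- `λ_F(p) = F(0) - F(log_x p)` for a prime `p` (the divisors of `p` are `1, p`). [folklore] -/
theorem divisorSumWeight_prime (F : ℝ → ℝ) (x : ℝ) {p : ℕ} (hp : p.Prime) :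
    divisorSumWeight F x p = F 0 - F (Real.log p / Real.log x) := by
  rw [divisorSumWeight, hp.divisors, Finset.sum_pair hp.one_lt.ne]
  simp [ArithmeticFunction.moebius_apply_prime hp, sub_eq_add_neg]

/-- (lambdan-prime), Polymath 8b p. 9: "if `F` is supported on `[0,1]`, then `λ_F(n) = F(0)` when `n ≥ x`
is prime"; general form: if `F` vanishes beyond `s` and `p > x^s` is prime (`x > 1`), then `λ_F(p) = F(0)`.
[cite: Polymath8b2014, §3, p. 9, (lambdan-prime)] -/
theorem divisorSumWeight_prime_eq {F : ℝ → ℝ} {s x : ℝ} (hF : ∀ t, s < t → F t = 0) (hx : 1 < x)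
    {p : ℕ} (hp : p.Prime) (hps : x ^ s < p) : divisorSumWeight F x p = F 0 := by
  rw [divisorSumWeight_prime F x hp, hF (Real.log p / Real.log x) ?_, sub_zero]
  have hlog : 0 < Real.log x := Real.log_pos hx
  rw [lt_div_iff₀ hlog, ← Real.log_rpow (by linarith)]
  exact Real.log_lt_log (Real.rpow_pos_of_pos (by linarith) s) hps

/-! ### Theorem 3.12(i), sieve-theoretic part: `DHL` from tensor-product weights -/

section Tensor

variable {ι : Type*}

/-- `α := ∑_{j} ∑_{j'} c_j c_{j'} ∏_{i=1}^k ∫₀¹ f'_{i,j}(t) f'_{i,j'}(t) dt`, the main-term coefficient of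
`∑ ν(n)` for `ν = (∑_j c_j ∏ᵢ λ_{f_{i,j}}(n + hᵢ))²` (Polymath 8b, §5.1, p. 21, display defining `α`, which
then "factorizes as `Ĩ(f₄)`"; reused in §5.3, p. 22).  The integrals are over `[0, 1]` as in Theorem 3.6.
[cite: Polymath8b2014, §5.1, p. 21 (definition of α)] -/
def tensorAlpha {k : ℕ} (J : Finset ι) (c : ι → ℝ) (f : Fin k → ι → ℝ → ℝ) : ℝ :=
  ∑ j ∈ J, ∑ j' ∈ J, c j * c j' * ∏ i, ∫ t in (0 : ℝ)..1, deriv (f i j) t * deriv (f i j') t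

/-- `β_{i₀} := (∑_{j ∈ 𝒥₁} + 2 ∑_{j ∈ 𝒥₂}) ∑_{j' ∈ 𝒥₁} c_j c_{j'} f_{i₀,j}(0) f_{i₀,j'}(0) ∏_{i ≠ i₀} ∫₀¹ f'_{i,j} f'_{i,j'}`,
the main-term coefficient of the lower bound for `∑ ν(n) θ(n + h_{i₀})` (Polymath 8b, §5.3, p. 22, display
defining `β_k`, "a similar argument" for general `i`, p. 23), with `𝒥₁ = J₁ i₀ ⊆ J` and `𝒥₂ = J ∖ 𝒥₁`
encoded by the weight `1` resp. `2`. [cite: Polymath8b2014, §5.3, p. 22 (definition of β_k)] -/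
def tensorBeta [DecidableEq ι] {k : ℕ} (J : Finset ι) (c : ι → ℝ) (f : Fin k → ι → ℝ → ℝ)
    (J₁ : Fin k → Finset ι) (i₀ : Fin k) : ℝ :=
  ∑ j ∈ J, ∑ j' ∈ J₁ i₀, (if j ∈ J₁ i₀ then (1 : ℝ) else 2) * (c j * c j') *
    (f i₀ j 0 * f i₀ j' 0) *
      ∏ i ∈ univ.erase i₀, ∫ t in (0 : ℝ)..1, deriv (f i j) t * deriv (f i j') t

/-- `(∑_j a_j)² = ∑_j ∑_{j'} a_j a_{j'}` ("Expanding out the square", Polymath 8b p. 21). [folklore] -/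
theorem sq_sum_eq_sum_sum (J : Finset ι) (a : ι → ℝ) :
    (∑ j ∈ J, a j) ^ 2 = ∑ j ∈ J, ∑ j' ∈ J, a j * a j' := by
  rw [sq, Finset.sum_mul_sum]

/-- The elementary inequality `(x₁ + x₂)² = x₁² + 2x₁x₂ + x₂² ≥ (x₁ + 2x₂) x₁` (Polymath 8b, §5.3, p. 22).
[cite: Polymath8b2014, §5.3, p. 22] -/
theorem add_sq_ge (x₁ x₂ : ℝ) : (x₁ + 2 * x₂) * x₁ ≤ (x₁ + x₂) ^ 2 := by
  nlinarith [sq_nonneg x₂]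

/-- **Polymath 8b, Theorem 3.12(i) — sieve-theoretic part of the proof** (§5.3, pp. 21–23).  Let `k ≥ 2`,
`m ≥ 1`, `0 < ϑ < 1` with `EH[ϑ]` (`PrimesHaveLevel ϑ`).  Let `ν(n) := (∑_{j ∈ J} c_j ∏ᵢ λ_{f_{i,j}}(n + hᵢ))²`
((nu-def), p. 21) with smooth cutoffs `f_{i,j}`, `S(f_{i,j}) ≤ s_{i,j}`, such that
`∑ᵢ (s_{i,j} + s_{i,j'}) < 1` for all `j, j'` (so Theorem 3.6(i) evaluates `∑ ν(n) = (α + o(1)) B^{-k} x/W`),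
and subsets `𝒥₁(i₀) ⊆ J` with `∑_{i ≠ i₀} (s_{i,j} + s_{i,j'}) < ϑ` for `j ∈ J`, `j' ∈ 𝒥₁(i₀)` (so Theorem
3.5(i) applies to these pairs).  By (lambdan-prime) and `(x₁ + x₂)² ≥ (x₁ + 2x₂) x₁`,
`∑ ν(n) θ(n + h_{i₀}) ≥ (β_{i₀} - o(1)) B^{1-k} x/φ(W)` (p. 22), and Lemma 3.4 gives `DHL[k, m+1]` provided
`m α < β₁ + ⋯ + β_k`.  The tuple `H` (a `Finset ℤ` of cardinality `k`) is indexed by `Fin k` through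
`Finset.equivFinOfCardEq`. [cite: Polymath8b2014, Theorem 3.12(i) (proof, §5.3, pp. 21–23)] -/
theorem weakDHL_of_tensorWeights [DecidableEq ι] (h35 : theta_divisorSumWeights_asymptotic)
    (h36 : divisorSumWeights_asymptotic) {k m : ℕ} (hk : 2 ≤ k) (hm : 1 ≤ m)
    {θ : ℝ} (hθ0 : 0 < θ) (hθ1 : θ < 1) (hθ : PrimesHaveLevel θ)
    (J : Finset ι) (c : ι → ℝ) (f : Fin k → ι → ℝ → ℝ) (s : Fin k → ι → ℝ)
    (J₁ : Fin k → Finset ι) (hJ₁ : ∀ i, J₁ i ⊆ J)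
    (hf : ∀ i, ∀ j ∈ J, IsSieveCutoff (f i j) (s i j))
    (hs1 : ∀ j ∈ J, ∀ j' ∈ J, ∑ i, (s i j + s i j') < 1)
    (hsθ : ∀ i₀, ∀ j ∈ J, ∀ j' ∈ J₁ i₀, ∑ i ∈ univ.erase i₀, (s i j + s i j') < θ)
    (hkey : (m : ℝ) * tensorAlpha J c f < ∑ i, tensorBeta J c f J₁ i) :
    WeakDicksonHardyLittlewood k (m + 1) := by
  classical
  refine weakDHL_of_sieveWeights' hk hm fun H hH hcard b hb => ?_
  -- index `H` by `Fin k`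
  set e : Fin k ≃ ↥H := (Finset.equivFinOfCardEq hcard).symm with he
  set emb : Fin k ↪ ℤ := ⟨fun i => (e i : ℤ), fun i j hij => e.injective (Subtype.ext hij)⟩
    with hemb
  have hemb_apply : ∀ i, emb i = (e i : ℤ) := fun i => rfl
  have hmapu : (univ : Finset (Fin k)).map emb = H := by
    ext h
    simp only [Finset.mem_map, Finset.mem_univ, true_and, hemb_apply]
    constructor
    · rintro ⟨i, rfl⟩
      exact (e i).2
    · intro hh
      exact ⟨e.symm ⟨h, hh⟩, by simp⟩
  have hmape : ∀ i₀, (univ.erase i₀).map emb = H.erase (e i₀ : ℤ) := fun i₀ => by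
    rw [Finset.map_erase, hmapu, hemb_apply]
  have hsumH : ∀ g : ℤ → ℝ, ∑ h ∈ H, g h = ∑ i, g (e i) := fun g => by
    have := Finset.sum_map (univ : Finset (Fin k)) emb g
    rwa [hmapu] at this
  have hprodH : ∀ g : ℤ → ℝ, ∏ h ∈ H, g h = ∏ i, g (e i) := fun g => by
    have := Finset.prod_map (univ : Finset (Fin k)) emb g
    rwa [hmapu] at this
  have hsumHe : ∀ (g : ℤ → ℝ) (i₀ : Fin k),
      ∑ h ∈ H.erase (e i₀ : ℤ), g h = ∑ i ∈ univ.erase i₀, g (e i) := fun g i₀ => by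
    have := Finset.sum_map (univ.erase i₀) emb g
    rwa [hmape] at this
  have hprodHe : ∀ (g : ℤ → ℝ) (i₀ : Fin k),
      ∏ h ∈ H.erase (e i₀ : ℤ), g h = ∏ i ∈ univ.erase i₀, g (e i) := fun g i₀ => by
    have := Finset.prod_map (univ.erase i₀) emb g
    rwa [hmape] at this
  -- the functions attached to `h ∈ H`
  set F : ℤ → ι → ℝ → ℝ := fun h => if hh : h ∈ H then f (e.symm ⟨h, hh⟩) else fun _ _ => 0
    with hF
  set S : ℤ → ι → ℝ := fun h => if hh : h ∈ H then s (e.symm ⟨h, hh⟩) else fun _ => 0 with hS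
  have hFe : ∀ i, F (e i) = f i := fun i => by
    simp only [hF, dif_pos (e i).2, Subtype.coe_eta, Equiv.symm_apply_apply]
  have hSe : ∀ i, S (e i) = s i := fun i => by
    simp only [hS, dif_pos (e i).2, Subtype.coe_eta, Equiv.symm_apply_apply]
  have hFS : ∀ h ∈ H, ∀ j ∈ J, IsSieveCutoff (F h j) (S h j) := fun h hh j hj => by
    obtain ⟨i, rfl⟩ : ∃ i, (e i : ℤ) = h := ⟨e.symm ⟨h, hh⟩, by simp⟩
    rw [hFe, hSe]
    exact hf i j hj
  -- the weights `ν(n) = (Σ_j c_j ∏_h λ_{f_{h,j}}(n+h))²`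
  set P : ι → ℝ → ℕ → ℝ := fun j x n =>
    ∏ h ∈ H, divisorSumWeight (F h j) x ((n : ℤ) + h).toNat with hP
  set ν : ℝ → ℕ → ℝ := fun x n => (∑ j ∈ J, c j * P j x n) ^ 2 with hν
  set β : ℤ → ℝ := fun h => if hh : h ∈ H then tensorBeta J c f J₁ (e.symm ⟨h, hh⟩) else 0 with hβ
  have hβe : ∀ i, β (e i) = tensorBeta J c f J₁ i := fun i => by
    simp only [hβ, dif_pos (e i).2, Subtype.coe_eta, Equiv.symm_apply_apply]
  have hk1 : 1 ≤ #H := by omega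
  have hk2 : 2 ≤ #H := by omega
  refine ⟨ν, tensorAlpha J c f, β, fun x n => sq_nonneg _, ?_, ?_, ?_⟩
  · /- upper bound: Theorem 3.6(i) for each pair `(j, j')` -/
    intro δ hδ
    set M : ℝ → ℝ := fun x => x / (polymathB x ^ k * polymathW x) with hM
    have hpair : ∀ j ∈ J, ∀ j' ∈ J,
        (fun x : ℝ => ∑ n ∈ polymathRange x (b x), P j x n * P j' x n -
          (∏ i, ∫ t in (0 : ℝ)..1, deriv (f i j) t * deriv (f i j') t) * M x) =o[atTop] M := by
      intro j hj j' hj'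
      have h := h36 H hH hk1 b hb (fun h => F h j) (fun h => F h j') (fun h => S h j)
        (fun h => S h j') (fun h hh => hFS h hh j hj) (fun h hh => hFS h hh j' hj') ?_
      · rw [hcard] at h
        refine h.congr_left fun x => ?_
        simp only [hP, hM, ← Finset.prod_mul_distrib]
        rw [hprodH (fun h => ∫ t in (0 : ℝ)..1, deriv (F h j) t * deriv (F h j') t)]
        simp only [hFe]
      · rw [hsumH (fun h => S h j + S h j')]
        simpa only [hSe] using hs1 j hj j' hj'
    have hsum : (fun x : ℝ => ∑ n ∈ polymathRange x (b x), ν x n - tensorAlpha J c f * M x)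
        =o[atTop] M := by
      have h := IsLittleO.sum fun j hj => IsLittleO.sum fun j' hj' =>
        (hpair j hj j' hj').const_mul_left (c j * c j')
      refine h.congr_left fun x => ?_
      have hI : ∑ n ∈ polymathRange x (b x), ν x n =
          ∑ j ∈ J, ∑ j' ∈ J, c j * c j' * ∑ n ∈ polymathRange x (b x), P j x n * P j' x n := by
        simp only [hν, sq_sum_eq_sum_sum]
        rw [Finset.sum_comm]
        refine Finset.sum_congr rfl fun j _ => ?_
        rw [Finset.sum_comm]
        refine Finset.sum_congr rfl fun j' _ => ?_
        rw [Finset.mul_sum]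
        refine Finset.sum_congr rfl fun n _ => ?_
        ring
      rw [hI, tensorAlpha, Finset.sum_mul, ← Finset.sum_sub_distrib]
      refine Finset.sum_congr rfl fun j _ => ?_
      rw [Finset.sum_mul, ← Finset.sum_sub_distrib]
      refine Finset.sum_congr rfl fun j' _ => ?_
      ring
    filter_upwards [hsum.def hδ, eventually_gt_atTop 1] with x hx hx1
    have hM0 : 0 < M x := by
      have := polymathB_pos hx1
      have := polymathW_pos x
      simp only [hM]
      positivity
    rw [Real.norm_eq_abs, Real.norm_eq_abs, abs_of_pos hM0] at hx
    have h1 := (abs_sub_le_iff.1 hx).1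
    rw [mul_div_assoc]
    change _ ≤ (tensorAlpha J c f + δ) * M x
    linarith
  · /- lower bound: Theorem 3.5(i) for pairs `(j, j')` with `j' ∈ 𝒥₁` -/
    intro h₀ hh₀ δ hδ
    obtain ⟨i₀, hi₀⟩ : ∃ i₀, (e i₀ : ℤ) = h₀ := ⟨e.symm ⟨h₀, hh₀⟩, by simp⟩
    subst hi₀
    set M' : ℝ → ℝ := fun x => x / (polymathB x ^ (k - 1) * Nat.totient (polymathW x)) with hM'
    have hpair : ∀ j ∈ J, ∀ j' ∈ J₁ i₀,
        (fun x : ℝ => ∑ n ∈ polymathRange x (b x), GPY.theta ((n : ℤ) + e i₀).toNat *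
            ∏ h ∈ H.erase (e i₀), (divisorSumWeight (F h j) x ((n : ℤ) + h).toNat *
              divisorSumWeight (F h j') x ((n : ℤ) + h).toNat) -
          (∏ i ∈ univ.erase i₀, ∫ t in (0 : ℝ)..1, deriv (f i j) t * deriv (f i j') t) * M' x)
          =o[atTop] M' := by
      intro j hj j' hj'
      have hj'J : j' ∈ J := hJ₁ i₀ hj'
      have h := h35 H hH hk2 b hb (e i₀) (e i₀).2 θ hθ0 hθ1 hθ (fun h => F h j) (fun h => F h j')
        (fun h => S h j) (fun h => S h j')
        (fun h hh => hFS h (Finset.mem_of_mem_erase hh) j hj)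
        (fun h hh => hFS h (Finset.mem_of_mem_erase hh) j' hj'J) ?_
      · rw [hcard] at h
        refine h.congr_left fun x => ?_
        simp only [hM']
        rw [hprodHe (fun h => ∫ t in (0 : ℝ)..1, deriv (F h j) t * deriv (F h j') t)]
        simp only [hFe]
      · rw [hsumHe (fun h => S h j + S h j')]
        simpa only [hSe] using hsθ i₀ j hj j' hj'
    set w : ι → ℝ := fun j => if j ∈ J₁ i₀ then 1 else 2 with hw
    have hT : (fun x : ℝ => ∑ j ∈ J, ∑ j' ∈ J₁ i₀, w j * (c j * c j') * (f i₀ j 0 * f i₀ j' 0) *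
          ∑ n ∈ polymathRange x (b x), GPY.theta ((n : ℤ) + e i₀).toNat *
            ∏ h ∈ H.erase (e i₀), (divisorSumWeight (F h j) x ((n : ℤ) + h).toNat *
              divisorSumWeight (F h j') x ((n : ℤ) + h).toNat)
          - tensorBeta J c f J₁ i₀ * M' x) =o[atTop] M' := by
      have h := IsLittleO.sum fun j hj => IsLittleO.sum fun j' hj' =>
        (hpair j hj j' hj').const_mul_left (w j * (c j * c j') * (f i₀ j 0 * f i₀ j' 0))
      refine h.congr_left fun x => ?_
      rw [tensorBeta, Finset.sum_mul, ← Finset.sum_sub_distrib]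
      refine Finset.sum_congr rfl fun j _ => ?_
      rw [Finset.sum_mul, ← Finset.sum_sub_distrib]
      refine Finset.sum_congr rfl fun j' _ => ?_
      simp only [hw]
      ring
    -- for large `x` the cutoffs see `n + h₀` as a prime beyond their support
    have hlarge : ∀ᶠ x : ℝ in atTop, 1 < x ∧ 4 * |((e i₀ : ℤ) : ℝ)| ≤ x ∧
        ∀ j ∈ J, 3 * x ^ (s i₀ j) ≤ x := by
      refine (eventually_gt_atTop 1).and ((eventually_ge_atTop _).and
        ((Finset.eventually_all J).2 fun j hj => ?_))
      have hs : s i₀ j < 1 := by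
        have := hs1 j hj j hj
        have h2 : s i₀ j + s i₀ j ≤ ∑ i, (s i j + s i j) :=
          Finset.single_le_sum (f := fun i => s i j + s i j)
            (fun i _ => by have := (hf i j hj).nonneg; positivity) (Finset.mem_univ i₀)
        linarith
      have ht : Tendsto (fun x : ℝ => x ^ (1 - s i₀ j)) atTop atTop :=
        tendsto_rpow_atTop (by linarith)
      filter_upwards [ht.eventually_ge_atTop 3, eventually_gt_atTop 0] with x hx hx0
      calc 3 * x ^ s i₀ j ≤ x ^ (1 - s i₀ j) * x ^ s i₀ j := by gcongr
        _ = x := by rw [← Real.rpow_add hx0]; simp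
    filter_upwards [hT.def hδ, hlarge] with x hx ⟨hx1, hxh, hxs⟩
    have hM'0 : 0 < M' x := by
      have := polymathB_pos hx1
      have := totient_polymathW_pos x
      simp only [hM']
      positivity
    rw [Real.norm_eq_abs, Real.norm_eq_abs, abs_of_pos hM'0] at hx
    have hTge := (abs_sub_le_iff.1 hx).2
    rw [hβe, mul_div_assoc]
    change (tensorBeta J c f J₁ i₀ - δ) * M' x ≤ _
    refine le_trans (by linarith [hTge]) ?_
    -- `T(x) ≤ Σ_n ν(n) θ(n + h₀)`, pointwise in `n`
    have hpt : ∀ n ∈ polymathRange x (b x),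
        ∑ j ∈ J, ∑ j' ∈ J₁ i₀, w j * (c j * c j') * (f i₀ j 0 * f i₀ j' 0) *
          (GPY.theta ((n : ℤ) + e i₀).toNat *
            ∏ h ∈ H.erase (e i₀), (divisorSumWeight (F h j) x ((n : ℤ) + h).toNat *
              divisorSumWeight (F h j') x ((n : ℤ) + h).toNat)) ≤
        ν x n * GPY.theta ((n : ℤ) + e i₀).toNat := by
      intro n hn
      obtain ⟨hxn, hn2⟩ := le_of_mem_polymathRange (by linarith) hn
      by_cases hprime : ((n : ℤ) + e i₀).toNat.Prime
      · have hq_gt : ∀ j ∈ J, x ^ s i₀ j < ((n : ℤ) + e i₀).toNat := by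
          intro j hj
          have h0 : (0 : ℝ) ≤ n + ((e i₀ : ℤ) : ℝ) := by
            linarith [neg_abs_le (((e i₀ : ℤ) : ℝ)), abs_nonneg (((e i₀ : ℤ) : ℝ))]
          have h1 : ((((n : ℤ) + e i₀).toNat : ℕ) : ℝ) = n + ((e i₀ : ℤ) : ℝ) := by
            have : ((((n : ℤ) + e i₀).toNat : ℕ) : ℤ) = n + e i₀ :=
              Int.toNat_of_nonneg (by exact_mod_cast h0)
            exact_mod_cast this
          rw [h1]
          have := hxs j hj
          linarith [neg_abs_le (((e i₀ : ℤ) : ℝ)), Real.rpow_nonneg (by linarith : (0:ℝ) ≤ x) (s i₀ j)]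
        have hPj : ∀ j ∈ J, P j x n = f i₀ j 0 *
            ∏ h ∈ H.erase (e i₀ : ℤ), divisorSumWeight (F h j) x ((n : ℤ) + h).toNat := by
          intro j hj
          simp only [hP]
          rw [← Finset.mul_prod_erase H _ (e i₀).2, hFe,
            divisorSumWeight_prime_eq (hf i₀ j hj).eq_zero hx1 hprime (hq_gt j hj)]
        calc ∑ j ∈ J, ∑ j' ∈ J₁ i₀, w j * (c j * c j') * (f i₀ j 0 * f i₀ j' 0) *
              (GPY.theta ((n : ℤ) + e i₀).toNat *
                ∏ h ∈ H.erase (e i₀), (divisorSumWeight (F h j) x ((n : ℤ) + h).toNat *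
                  divisorSumWeight (F h j') x ((n : ℤ) + h).toNat))
            = (∑ j ∈ J, w j * (c j * P j x n)) * (∑ j' ∈ J₁ i₀, c j' * P j' x n) *
                GPY.theta ((n : ℤ) + e i₀).toNat := by
              rw [Finset.sum_mul, Finset.sum_mul]
              refine Finset.sum_congr rfl fun j hj => ?_
              rw [Finset.mul_sum, Finset.sum_mul]
              refine Finset.sum_congr rfl fun j' hj' => ?_
              rw [hPj j hj, hPj j' (hJ₁ i₀ hj'), Finset.prod_mul_distrib]
              ring
          _ ≤ ν x n * GPY.theta ((n : ℤ) + e i₀).toNat := by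
              have hsplit : ∑ j ∈ J, c j * P j x n =
                  ∑ j ∈ J₁ i₀, c j * P j x n + ∑ j ∈ J.filter (· ∉ J₁ i₀), c j * P j x n := by
                rw [← Finset.sum_filter_add_sum_filter_not J (· ∈ J₁ i₀), Finset.filter_mem_eq_inter,
                  Finset.inter_eq_right.2 (hJ₁ i₀)]
              have hsplit' : ∑ j ∈ J, w j * (c j * P j x n) =
                  ∑ j ∈ J₁ i₀, c j * P j x n + 2 * ∑ j ∈ J.filter (· ∉ J₁ i₀), c j * P j x n := by
                simp only [hw, ite_mul, one_mul]
                rw [Finset.sum_ite, Finset.filter_mem_eq_inter, Finset.inter_eq_right.2 (hJ₁ i₀),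
                  ← Finset.mul_sum]
              rw [hsplit', hν]
              simp only
              rw [hsplit]
              exact mul_le_mul_of_nonneg_right (add_sq_ge _ _) (GPY.theta_nonneg _)
      · simp [GPY.theta_of_not_prime hprime]
    calc ∑ j ∈ J, ∑ j' ∈ J₁ i₀, w j * (c j * c j') * (f i₀ j 0 * f i₀ j' 0) *
          ∑ n ∈ polymathRange x (b x), GPY.theta ((n : ℤ) + e i₀).toNat *
            ∏ h ∈ H.erase (e i₀), (divisorSumWeight (F h j) x ((n : ℤ) + h).toNat *
              divisorSumWeight (F h j') x ((n : ℤ) + h).toNat)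
        = ∑ n ∈ polymathRange x (b x), ∑ j ∈ J, ∑ j' ∈ J₁ i₀,
            w j * (c j * c j') * (f i₀ j 0 * f i₀ j' 0) *
              (GPY.theta ((n : ℤ) + e i₀).toNat *
                ∏ h ∈ H.erase (e i₀), (divisorSumWeight (F h j) x ((n : ℤ) + h).toNat *
                  divisorSumWeight (F h j') x ((n : ℤ) + h).toNat)) := by
          symm
          rw [Finset.sum_comm]
          refine Finset.sum_congr rfl fun j _ => ?_
          rw [Finset.sum_comm]
          refine Finset.sum_congr rfl fun j' _ => ?_
          rw [Finset.mul_sum]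
      _ ≤ ∑ n ∈ polymathRange x (b x), ν x n * GPY.theta ((n : ℤ) + e i₀).toNat :=
          Finset.sum_le_sum hpt
  · /- the key inequality -/
    rw [hsumH β]
    simpa only [hβe] using hkey

/-- **Polymath 8b, §5.3 (with §5.1), analytic part of the proof of Theorem 3.12(i)** (pp. 19–23):
from a test function `F` on `(1+ε) · R_k` with `(∑ᵢ J_{i,1-ε}(F))/I(F) > 2m/θ` one "may eventually arrive
at" a finite combination `f₄ = ∑_j c_j f_{1,j}(t₁) ⋯ f_{k,j}(t_k)` of smooth compactly supported one-variable
cutoffs (truncation, rescaling by `θ/2 - δ₁`, translation, mollification, `f₃ = ∫_{s ≥ t} F₃`,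
Stone–Weierstrass, smooth partition into intervals of length `≤ δ₃`) such that
`S(f_{1,j}) + ⋯ + S(f_{k,j}) < (1+ε) θ/2` for every `j` ((sff), p. 22) and, with
`𝒥₁ = {j : ∑_{i ≠ i₀} S(f_{i,j}) < (1-ε) θ/2}` ((sff-minus), p. 22), the quantities `α = Ĩ(f₄)`
(`tensorAlpha`) and `β_{i₀}` (`tensorBeta`, p. 22) satisfy the key inequality `β₁ + ⋯ + β_k > m α` of
Lemma 3.4 ("If we choose `δ₃` small enough", p. 23, via `β_i = J̃_{i,(1-ε)θ/2}(f₄) + O(δ₃)` and (f4-ratio)).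
Pure real analysis (no distribution hypothesis is involved); NOT proved here. The hypotheses are those
of Theorem 3.12(i) except `EH[θ]`. [cite: Polymath8b2014, §5.3, pp. 21–23] -/
def exists_tensorCutoffs_of_polymathFunctional_gt : Prop :=
  ∀ (k m : ℕ), 2 ≤ k → 1 ≤ m → ∀ (ε : ℝ), 0 < ε → ε < 1 → ∀ (θ : ℝ), 0 < θ → θ < 1 →
    1 + ε < 1 / θ → ∀ (F : (Fin k → ℝ) → ℝ), IsPolymathTestFunction k ε F →
    2 * (m : ℝ) / θ < polymathFunctional k ε F →
    ∃ (n : ℕ) (c : Fin n → ℝ) (f : Fin k → Fin n → ℝ → ℝ) (s : Fin k → Fin n → ℝ),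
      (∀ i j, IsSieveCutoff (f i j) (s i j)) ∧
      (∀ j, ∑ i, s i j < (1 + ε) * θ / 2) ∧
      (m : ℝ) * tensorAlpha univ c f <
        ∑ i₀, tensorBeta univ c f
          (fun i₁ => univ.filter fun j => ∑ i ∈ univ.erase i₁, s i j < (1 - ε) * θ / 2) i₀

/-- **Polymath 8b, Theorem 3.12(i) from its printed ingredients** (§5.3): the sieve asymptotics
Theorem 3.5(i) (`theta_divisorSumWeights_asymptotic`) and Theorem 3.6(i)
(`divisorSumWeights_asymptotic`), the analytic approximation step of §5.3
(`exists_tensorCutoffs_of_polymathFunctional_gt`), Lemma 3.4 and the pointwise lower bound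
`(x₁ + x₂)² ≥ (x₁ + 2x₂) x₁` (`weakDHL_of_tensorWeights`, proved above).  The support bookkeeping of
p. 22: `∑ᵢ (S(f_{i,j}) + S(f_{i,j'})) < (1+ε)θ < 1` makes Theorem 3.6(i) available, and for `j' ∈ 𝒥₁`
`∑_{i ≠ i₀} (S(f_{i,j}) + S(f_{i,j'})) < (1+ε)θ/2 + (1-ε)θ/2 = θ` makes Theorem 3.5(i) available.
[cite: Polymath8b2014, Theorem 3.12(i) (proof, §5.3)] -/
theorem weakDHL_of_polymathFunctional_gt_of_parts (h35 : theta_divisorSumWeights_asymptotic)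
    (h36 : divisorSumWeights_asymptotic) (h53 : exists_tensorCutoffs_of_polymathFunctional_gt) :
    weakDHL_of_polymathFunctional_gt := by
  intro k m hk hm ε hε0 hε1 θ hθ0 hθ1 hθ hεθ F hF hM
  obtain ⟨n, c, f, s, hf, hs, hkey⟩ := h53 k m hk hm ε hε0 hε1 θ hθ0 hθ1 hεθ F hF hM
  have hθε : (1 + ε) * θ < 1 := by
    have h := (lt_div_iff₀ hθ0).1 hεθ
    linarith
  have hs0 : ∀ i j, 0 ≤ s i j := fun i j => (hf i j).nonneg
  refine weakDHL_of_tensorWeights h35 h36 hk hm hθ0 hθ1 hθ univ c f s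
    (fun i₁ => univ.filter fun j => ∑ i ∈ univ.erase i₁, s i j < (1 - ε) * θ / 2)
    (fun _ => Finset.filter_subset _ _) (fun i j _ => hf i j) ?_ ?_ hkey
  · intro j _ j' _
    rw [Finset.sum_add_distrib]
    linarith [hs j, hs j']
  · intro i₀ j _ j' hj'
    have h1 : ∑ i ∈ univ.erase i₀, s i j' < (1 - ε) * θ / 2 := (Finset.mem_filter.1 hj').2
    have h2 : ∑ i ∈ univ.erase i₀, s i j ≤ ∑ i, s i j :=
      Finset.sum_le_sum_of_subset_of_nonneg (Finset.erase_subset _ _) fun i _ _ => hs0 i j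
    rw [Finset.sum_add_distrib]
    linarith [hs j]

end Tensor

end Literature.NumberTheory.Sieve
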